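import Summits.QuantumFields.GaugeBoot.PlanarCertificateSoundnessZd
import Summits.QuantumFields.GaugeBoot.ZdWordSymmetry
import Literature.MathematicalPhysics.QuantumFieldTheory.ShenZhuZhuLargeNFactorization
import HarnessLib

/-!
# Kazakov–Zheng's identification of loops "by shape" at finite `N`: exact for single loops and JOINTLY moved pairs, a covariance defect for the class-indexed relaxation variables (gauge-boot, large-`N` supplement 7)

HONEST FRAMING (cell `pub-gaugeboot`, page 1 of every file): the venture produces certified bounds
on lattice expectations at stated coupling, gauge group, dimension and torus size; NOT a mass gap,
NOT a continuum limit, NOT a string tension; NOT large `N` unless marked CONDITIONAL; NOT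
Yang–Mills-summit-bearing (barriers `FixedCouplingUltralocality`, `PerturbativeInvisibility`).
This file quantifies one more finite-`N` defect of a planar certificate; it certifies no number.

## Content

The planar SDP of Kazakov–Zheng indexes its unknowns by EQUIVALENCE CLASSES of loops (translations,
hyperoctahedral moves, cyclic rotation, reversal, backtrack reduction) — and its relaxation variables
`Q_{ij} = W_i W_j` by PAIRS OF CLASSES.  Read at finite `N` (`PlanarLoopDataZd`: `W = Re E t`,
`Q(A,B) = Re E[t_A t_B]`):

* SINGLE loops: the identifications are EXACT for the states having the symmetry —
  `loopTrZd_conjPath` (a loop read through a path `p` is the conjugate holonomy: `t_x(p·C·p⁻¹) =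
  t_y(C)` POINTWISE), `loopW_add` / `loopQ_add` (translation-invariant states:
  the base point is immaterial, pairs moved JOINTLY), `loopW_conjPath` (hence `W_x(p·C·p⁻¹) = W_x(C)`);
  reversal and backtracks are pointwise (`PlanarLoopDataZd.loopTrZd_reverse`,
  `ClassBWords.wordHolonomyZd_backtrack`).  This is the tree's "pairs need JOINT moves only"
  (`ZdPairLoopClasses`).
* PAIRS moved SEPARATELY — what a class-indexed `Q_{ij}` silently does — are NOT identified at
  finite `N`: ★★ `abs_loopQ_sub_loopQ_le` — for any probability state and words with `E t_{A'} = E t_A`,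
  `|Q(A', B) − Q(A, B)| ≤ E|t_{A'} − E t_{A'}| + E|t_A − E t_A| ≤ √Var(t_{A'}) + √Var(t_A)`
  (`Var t := Var(Re t) + Var(Im t)`): a COVARIANCE defect, vanishing under large-`N` factorisation
  of `|t_A|²` but NOT an imaginary-part moment — so a faithful replay of a class-indexed planar
  certificate at finite `N` pays, per such identification, a defect of the size of the fluctuations
  of the loop itself (★ `abs_loopQ_conjPath_sub_loopQ_le`: the translated copy `A' = p·A·p⁻¹`).
* ★★ `PlanarCertificate.obj_le_of_defects'` / `obj_loopW_le'` — the transfer theorem of supplement 4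
  with DEFECTIVE identification rows: `obj ≤ bound + Σ_r |y_r| ε_r + Σ_s γ_s + Σ_e |z_e| η_e`.

So the tree's position-indexed format (supplements 3–6) is the one whose finite-`N` defect is purely
imaginary-part; KZ's class-indexed `Q` adds real covariances.  Both vanish as `N → ∞` under
factorisation (SZZ at strong coupling: `ShenZhuZhuLargeNFactorization.integral_norm_sub_le_sqrt_variance`
is the Cauchy–Schwarz step used here).  [folklore]; Kazakov–Zheng arXiv:2203.11360 §3.2–3.3.
-/

noncomputable section

open MeasureTheory ProbabilityTheory
open scoped BigOperators
open Literature.Probability.LatticeModels (Site)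
open Literature.MathematicalPhysics.QuantumLattice
open Literature.RepresentationTheory.CompactGroups

namespace Summit.QuantumFields.GaugeBoot

variable {d N : ℕ}

/-- Translating the base point translates the endpoint. [folklore] -/
theorem Word.endpointZd_add_base (x v : Site d) : ∀ w : Word d, Word.endpointZd (x + v) w = Word.endpointZd x w + v
  | [] => rfl
  | s :: w => by
    have hs : s.applyZd (x + v) = s.applyZd x + v := by
      cases s with
      | fwd μ => simp only [Step.applyZd_fwd]; abel
      | bwd μ => simp only [Step.applyZd_bwd]; abel
    rw [Word.endpointZd_cons, Word.endpointZd_cons, hs, Word.endpointZd_add_base (s.applyZd x) v w]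

/-- A word closed at one base point is closed at every base point. [folklore] -/
theorem Word.endpointZd_eq_self_of_closed {x : Site d} {w : Word d} (hw : Word.endpointZd x w = x) (y : Site d) :
    Word.endpointZd y w = y := by
  have h := Word.endpointZd_add_base x (y - x) w
  rw [hw, add_sub_cancel] at h
  exact h

/-! ## The transfer theorem with defective identification rows -/

namespace PlanarCertificate

variable (P : PlanarCertificate d)

/-- ★★ **The abstract finite-`N` transfer with defective identification rows**: on any planar data,
a valid certificate gives `obj ≤ bound + Σ_r |y_r| ε_r + Σ_s γ_s + Σ_e |z_e| η_e` when the rows hold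
up to `ε_r`, the Gram blocks are non-negative, the relaxation terms are `≥ −γ_s` and the
identification rows hold up to `η_e`. [folklore] -/
theorem obj_le_of_defects' (hP : P.IsValid) (W : Word d → ℝ) (Q : Word d → Word d → ℝ)
    (ε : Fin P.nR → ℝ) (γ : Fin P.nS → ℝ) (η : Fin P.nE → ℝ)
    (hrow : ∀ r, |planarRow P.βt (P.rowAxis r) (P.rowWord r) W Q| ≤ ε r)
    (hgram : ∀ j, 0 ≤ gramPairing (P.gramWord j) (P.gramVec j) W)
    (hshor : ∀ s, -γ s ≤ P.shorTerm s W Q) (hlin : ∀ e, |P.lin e W Q| ≤ η e) :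
    P.obj W ≤ P.bound + ∑ r, |P.rowMult r| * ε r + ∑ s, γ s + ∑ e, |P.linMult e| * η e := by
  have h := hP W Q
  simp only [rhs] at h
  have h1 : 0 ≤ ∑ j, gramPairing (P.gramWord j) (P.gramVec j) W := Finset.sum_nonneg fun j _ => hgram j
  have h2 : -(∑ s, γ s) ≤ ∑ s, P.shorTerm s W Q := by
    rw [← Finset.sum_neg_distrib]; exact Finset.sum_le_sum fun s _ => hshor s
  have h3 : -(∑ r, |P.rowMult r| * ε r) ≤ ∑ r, P.rowMult r * planarRow P.βt (P.rowAxis r) (P.rowWord r) W Q := by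
    rw [← Finset.sum_neg_distrib]
    refine Finset.sum_le_sum fun r _ => ?_
    have := abs_le.1 ((abs_mul _ _).le.trans (mul_le_mul_of_nonneg_left (hrow r) (abs_nonneg (P.rowMult r))))
    linarith [this.1]
  have h4 : -(∑ e, |P.linMult e| * η e) ≤ ∑ e, P.linMult e * P.lin e W Q := by
    rw [← Finset.sum_neg_distrib]
    refine Finset.sum_le_sum fun e _ => ?_
    have := abs_le.1 ((abs_mul _ _).le.trans (mul_le_mul_of_nonneg_left (hlin e) (abs_nonneg (P.linMult e))))
    linarith [this.1]
  linarith

/-- ★★ **The generic state transfer with defective identification rows** (any compact `G`,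
continuous `ρ`, probability state on `ℤ^d`): `obj(W_μ) ≤ bound + Σ_r |y_r| ε_r + Σ_s γ_s(μ) + Σ_e |z_e| η_e`.
[folklore] -/
theorem obj_loopW_le' {G : Type*} [Group G] [TopologicalSpace G] [IsTopologicalGroup G] [CompactSpace G]
    [MeasurableSpace G] [BorelSpace G] (ρ : G →* Matrix (Fin N) (Fin N) ℂ) (hP : P.IsValid) (hρ : Continuous ρ)
    (μ : Measure (LGConfig d G)) [IsProbabilityMeasure μ] (x : Site d)
    (hgram : ∀ j i, Word.endpointZd x (P.gramWord j i) = x) (ε : Fin P.nR → ℝ) (η : Fin P.nE → ℝ)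
    (hrow : ∀ r, |planarRow P.βt (P.rowAxis r) (P.rowWord r) (loopW ρ μ x) (loopQ ρ μ x)| ≤ ε r)
    (hlin : ∀ e, |P.lin e (loopW ρ μ x) (loopQ ρ μ x)| ≤ η e) :
    P.obj (loopW ρ μ x) ≤ P.bound + ∑ r, |P.rowMult r| * ε r + ∑ s, P.shorDefect ρ μ x s + ∑ e, |P.linMult e| * η e :=
  P.obj_le_of_defects' hP _ _ ε (P.shorDefect ρ μ x) η hrow
    (fun j => gramPairing_loopW_nonneg ρ hρ μ x _ (hgram j) _)
    (fun s => shorPairing_loopData_ge ρ hρ μ x P.shorLoop (P.shorConst s) (P.shorVec s)) hlin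

end PlanarCertificate

/-! ## Single loops and jointly moved pairs: exact identifications -/

section Exact

variable {G : Type*} [Group G] [TopologicalSpace G] [IsTopologicalGroup G] [CompactSpace G]
  [MeasurableSpace G] [BorelSpace G] (ρ : G →* Matrix (Fin N) (Fin N) ℂ)

omit [TopologicalSpace G] [IsTopologicalGroup G] [CompactSpace G] [MeasurableSpace G] [BorelSpace G] in
/-- **A loop read through a path is the conjugate holonomy**: for a path word `p` from `x` to
`y = endpointZd x p` and a word `C` closed at `y`, `t_x(p · C · p⁻¹) = t_y(C)` POINTWISE
(`tr(g h g⁻¹) = tr h`). [folklore] -/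
theorem loopTrZd_conjPath (x : Site d) (p C : Word d) (hC : Word.endpointZd (Word.endpointZd x p) C = Word.endpointZd x p)
    (U : LGConfig d G) :
    loopTrZd ρ x (p ++ C ++ p.reverse) U = loopTrZd ρ (Word.endpointZd x p) C U := by
  rw [loopTrZd_apply, loopTrZd_apply, wordHolonomyZd_append, wordHolonomyZd_append, Word.endpointZd_append, hC,
    wordHolonomyZd_reverse, map_mul, map_mul, Matrix.trace_mul_cycle, ← map_mul, inv_mul_cancel, map_one,
    Matrix.one_mul]

variable (μ : Measure (LGConfig d G))

omit [TopologicalSpace G] [IsTopologicalGroup G] [CompactSpace G] [BorelSpace G] in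
/-- Hence `W_x(p · C · p⁻¹) = W_y(C)` for EVERY measure (`y = endpointZd x p`, `C` closed at `y`). [folklore] -/
theorem loopW_conjPath_eq (x : Site d) (p C : Word d) (hC : Word.endpointZd (Word.endpointZd x p) C = Word.endpointZd x p) :
    loopW ρ μ x (p ++ C ++ p.reverse) = loopW ρ μ (Word.endpointZd x p) C := by
  simp only [loopW, loopTrZd_conjPath ρ x p C hC]

omit [TopologicalSpace G] [IsTopologicalGroup G] [CompactSpace G] [BorelSpace G] in
/-- And `Q_x(p·A·p⁻¹, p·B·p⁻¹) = Q_y(A, B)` for EVERY measure: JOINTLY conjugated pairs are identified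
pointwise. [folklore] -/
theorem loopQ_conjPath_conjPath_eq (x : Site d) (p A B : Word d)
    (hA : Word.endpointZd (Word.endpointZd x p) A = Word.endpointZd x p)
    (hB : Word.endpointZd (Word.endpointZd x p) B = Word.endpointZd x p) :
    loopQ ρ μ x (p ++ A ++ p.reverse) (p ++ B ++ p.reverse) = loopQ ρ μ (Word.endpointZd x p) A B := by
  simp only [loopQ, loopTrZd_conjPath ρ x p A hA, loopTrZd_conjPath ρ x p B hB]

variable {μ}

omit [TopologicalSpace G] [IsTopologicalGroup G] [CompactSpace G] [BorelSpace G] in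
/-- **Translation-invariant states: the base point is immaterial for single loops**,
`W_{x+v}(C) = W_x(C)`. [folklore] -/
theorem loopW_add (hT : IsZdTranslationInvariant μ) (v x : Site d) (C : Word d) :
    loopW ρ μ (x + v) C = loopW ρ μ x C := by
  simp only [loopW, loopTrZd_apply, integral_div]
  rw [integral_trace_wordHolonomyZd_add ρ hT v x C]

omit [TopologicalSpace G] [IsTopologicalGroup G] [CompactSpace G] [BorelSpace G] in
/-- **… and for JOINTLY translated pairs**, `Q_{x+v}(A, B) = Q_x(A, B)`. [folklore] -/
theorem loopQ_add (hT : IsZdTranslationInvariant μ) (v x : Site d) (A B : Word d) :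
    loopQ ρ μ (x + v) A B = loopQ ρ μ x A B := by
  simp only [loopQ, loopTrZd_apply]
  have h := integral_trace_mul_trace_wordHolonomyZd_add ρ hT v x x A B
  have e : ∀ (y : Site d) (U : LGConfig d G),
      (ρ (wordHolonomyZd U y A)).trace / (N : ℂ) * ((ρ (wordHolonomyZd U y B)).trace / (N : ℂ)) =
        (ρ (wordHolonomyZd U y A)).trace * (ρ (wordHolonomyZd U y B)).trace / ((N : ℂ) * N) := fun y U => by ring
  simp_rw [e, integral_div, h]

omit [TopologicalSpace G] [IsTopologicalGroup G] [CompactSpace G] [BorelSpace G] in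
/-- **For translation-invariant states the shape determines `W`**: `W_x(p · C · p⁻¹) = W_x(C)`
whenever `C` is closed at `x` (the copy of `C` at `y = endpointZd x p`, read from `x` through `p`).
[folklore] -/
theorem loopW_conjPath (hT : IsZdTranslationInvariant μ) (x : Site d) (p C : Word d) (hC : Word.endpointZd x C = x) :
    loopW ρ μ x (p ++ C ++ p.reverse) = loopW ρ μ x C := by
  rw [loopW_conjPath_eq ρ μ x p C (Word.endpointZd_eq_self_of_closed hC _),
    show Word.endpointZd x p = x + (Word.endpointZd x p - x) by abel, loopW_add ρ hT]

end Exact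

/-! ## Separately moved pairs: the covariance defect -/

section Defect

variable {G : Type*} [Group G] [TopologicalSpace G] [IsTopologicalGroup G] [CompactSpace G]
  [MeasurableSpace G] [BorelSpace G] (ρ : G →* Matrix (Fin N) (Fin N) ℂ)

/-- `|E[(t − c) s]| ≤ E‖t − c‖` for `‖s‖ ≤ 1`. [folklore] -/
theorem norm_integral_sub_mul_le {Ω : Type*} [MeasurableSpace Ω] {μ : Measure Ω} [IsProbabilityMeasure μ]
    {t s : Ω → ℂ} (ht : AEStronglyMeasurable t μ) (ht1 : ∀ ω, ‖t ω‖ ≤ 1)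
    (hs1 : ∀ ω, ‖s ω‖ ≤ 1) (c : ℂ) :
    ‖∫ ω, (t ω - c) * s ω ∂μ‖ ≤ ∫ ω, ‖t ω - c‖ ∂μ := by
  have hi : Integrable (fun ω => ‖t ω - c‖) μ :=
    ((integrable_of_norm_le_one μ ht ht1).sub (integrable_const c)).norm
  refine (norm_integral_le_integral_norm _).trans (integral_mono_of_nonneg (Filter.Eventually.of_forall fun ω => norm_nonneg _)
    hi (Filter.Eventually.of_forall fun ω => ?_))
  show ‖(t ω - c) * s ω‖ ≤ ‖t ω - c‖
  rw [norm_mul]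
  exact mul_le_of_le_one_right (norm_nonneg _) (hs1 ω)

/-- ★★ **The class-indexed relaxation variable is consistent at finite `N` only up to covariances**:
for a probability state and words `A, A', B` based at `x` with `E t_{A'} = E t_A` (e.g. `A'` a
symmetry-related copy of `A` for a state with that symmetry),
`|Q(A', B) − Q(A, B)| ≤ E‖t_{A'} − E t_{A'}‖ + E‖t_A − E t_A‖`. [folklore] -/
theorem abs_loopQ_sub_loopQ_le (hρ : Continuous ρ) (μ : Measure (LGConfig d G)) [IsProbabilityMeasure μ] (x : Site d)
    (A A' B : Word d) (hmean : ∫ U, loopTrZd ρ x A' U ∂μ = ∫ U, loopTrZd ρ x A U ∂μ) :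
    |loopQ ρ μ x A' B - loopQ ρ μ x A B| ≤
      (∫ U, ‖loopTrZd ρ x A' U - ∫ V, loopTrZd ρ x A' V ∂μ‖ ∂μ) + ∫ U, ‖loopTrZd ρ x A U - ∫ V, loopTrZd ρ x A V ∂μ‖ ∂μ := by
  set c : ℂ := ∫ V, loopTrZd ρ x A V ∂μ with hc
  have hmA := aestronglyMeasurable_loopTrZd ρ hρ μ x A
  have hmA' := aestronglyMeasurable_loopTrZd ρ hρ μ x A'
  have hiAB := integrable_loopTrZd_mul ρ hρ μ x A B
  have hiA'B := integrable_loopTrZd_mul ρ hρ μ x A' B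
  have hicB : Integrable (fun U => c * loopTrZd ρ x B U) μ := (integrable_loopTrZd ρ hρ μ x B).const_mul c
  -- `E[t_{A'} t_B] − E[t_A t_B] = E[(t_{A'} − c) t_B] − E[(t_A − c) t_B]`
  have hdec : (∫ U, loopTrZd ρ x A' U * loopTrZd ρ x B U ∂μ) - ∫ U, loopTrZd ρ x A U * loopTrZd ρ x B U ∂μ =
      (∫ U, (loopTrZd ρ x A' U - c) * loopTrZd ρ x B U ∂μ) - ∫ U, (loopTrZd ρ x A U - c) * loopTrZd ρ x B U ∂μ := by
    have e1 : (fun U => (loopTrZd ρ x A' U - c) * loopTrZd ρ x B U) =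
        fun U => loopTrZd ρ x A' U * loopTrZd ρ x B U - c * loopTrZd ρ x B U := funext fun U => by ring
    have e2 : (fun U => (loopTrZd ρ x A U - c) * loopTrZd ρ x B U) =
        fun U => loopTrZd ρ x A U * loopTrZd ρ x B U - c * loopTrZd ρ x B U := funext fun U => by ring
    rw [e1, e2, integral_sub hiA'B hicB, integral_sub hiAB hicB]
    ring
  have hre : loopQ ρ μ x A' B - loopQ ρ μ x A B =
      ((∫ U, (loopTrZd ρ x A' U - c) * loopTrZd ρ x B U ∂μ) - ∫ U, (loopTrZd ρ x A U - c) * loopTrZd ρ x B U ∂μ).re := by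
    rw [loopQ, loopQ, ← Complex.sub_re, hdec]
  rw [hre]
  refine (Complex.abs_re_le_norm _).trans ((norm_sub_le _ _).trans (add_le_add ?_ ?_))
  · rw [hmean]
    exact norm_integral_sub_mul_le hmA' (norm_loopTrZd_le_one ρ hρ x A') (norm_loopTrZd_le_one ρ hρ x B) c
  · exact norm_integral_sub_mul_le hmA (norm_loopTrZd_le_one ρ hρ x A) (norm_loopTrZd_le_one ρ hρ x B) c

/-- The same in variances (Cauchy–Schwarz, SZZ's step):
`|Q(A', B) − Q(A, B)| ≤ √(Var Re t_{A'} + Var Im t_{A'}) + √(Var Re t_A + Var Im t_A)`. [folklore] -/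
theorem abs_loopQ_sub_loopQ_le_sqrt (hρ : Continuous ρ) (μ : Measure (LGConfig d G)) [IsProbabilityMeasure μ]
    (x : Site d) (A A' B : Word d) (hmean : ∫ U, loopTrZd ρ x A' U ∂μ = ∫ U, loopTrZd ρ x A U ∂μ) :
    |loopQ ρ μ x A' B - loopQ ρ μ x A B| ≤
      Real.sqrt (Var[fun U => (loopTrZd ρ x A' U).re; μ] + Var[fun U => (loopTrZd ρ x A' U).im; μ]) +
        Real.sqrt (Var[fun U => (loopTrZd ρ x A U).re; μ] + Var[fun U => (loopTrZd ρ x A U).im; μ]) :=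
  (abs_loopQ_sub_loopQ_le ρ hρ μ x A A' B hmean).trans (add_le_add
    (Literature.MathematicalPhysics.QuantumFieldTheory.integral_norm_sub_le_sqrt_variance _
      (aestronglyMeasurable_loopTrZd ρ hρ μ x A') (norm_loopTrZd_le_one ρ hρ x A'))
    (Literature.MathematicalPhysics.QuantumFieldTheory.integral_norm_sub_le_sqrt_variance _
      (aestronglyMeasurable_loopTrZd ρ hρ μ x A) (norm_loopTrZd_le_one ρ hρ x A)))

/-- ★ **The translated copy**: for a translation-invariant probability state, a word `A` closed at
`x` and its copy `A' = p · A · p⁻¹` at `y = endpointZd x p` read from `x`: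
`|Q(A', B) − Q(A, B)| ≤ E‖t_{A'} − E t_{A'}‖ + E‖t_A − E t_A‖` — identifying the relaxation
variables of `(A', B)` and `(A, B)` (as a class-indexed `Q_{ij}` does) costs the fluctuations of the
loop, not an imaginary-part moment. [folklore] -/
theorem abs_loopQ_conjPath_sub_loopQ_le (hρ : Continuous ρ) {μ : Measure (LGConfig d G)} [IsProbabilityMeasure μ]
    (hT : IsZdTranslationInvariant μ) (x : Site d) (p A B : Word d) (hA : Word.endpointZd x A = x) :
    |loopQ ρ μ x (p ++ A ++ p.reverse) B - loopQ ρ μ x A B| ≤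
      (∫ U, ‖loopTrZd ρ x (p ++ A ++ p.reverse) U - ∫ V, loopTrZd ρ x (p ++ A ++ p.reverse) V ∂μ‖ ∂μ) +
        ∫ U, ‖loopTrZd ρ x A U - ∫ V, loopTrZd ρ x A V ∂μ‖ ∂μ := by
  refine abs_loopQ_sub_loopQ_le ρ hρ μ x A _ B ?_
  -- `E t_x(p A p⁻¹) = E t_y(A) = E t_x(A)` by conjugation and translation invariance
  have hA' : Word.endpointZd (Word.endpointZd x p) A = Word.endpointZd x p := Word.endpointZd_eq_self_of_closed hA _
  simp only [loopTrZd_conjPath ρ x p A hA', loopTrZd_apply, integral_div]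
  rw [show Word.endpointZd x p = x + (Word.endpointZd x p - x) by abel, integral_trace_wordHolonomyZd_add ρ hT]

end Defect

end Summit.QuantumFields.GaugeBoot

end
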